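import Mathlib
import Summits.Schanuel.Schanuel.Theses.RigidCore
import Summits.Schanuel.Schanuel.Theorems.RigidCoreMinimalCounterexampleInAclCorankOne
import Summits.Schanuel.Schanuel.Theorems.RigidCoreMinimalCounterexampleInAclCorankGeTwoLogPart

/-!
# The leaf split of crux stmt-Schanuel-0969 `RigidCore.MinimalCounterexampleInAcl` (strategist, 2026-08-17)

Route `RigidCore`, `--supports stmt-Schanuel-0969` (registered stubs `MinimalCounterexampleInAcl_of_subs`,
`minimalCounterexampleInAcl_iff_subs`).  Glue theorem for the planner's decomposition
`ledger route edit route-Schanuel-RigidCore --split MinimalCounterexampleInAcl --into … --glue-by …`.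

After 17 lead cycles on three lines (dossiers `Cruxes/MinimalCounterexampleInAcl/Lines/*-dead.md`) the open content of
(S*) — "every coordinate of a first-failure counterexample to Schanuel's conjecture lies in `acl^{ℂ_exp}(∅)`" — is EXACTLY the
conjunction of three NECESSARY residues (lossless form `crux_iff_threeNecessaryResidues` of the line skeleton, over the landed
`crux_iff_pureTwistedResidue_and_corankGeTwo`, Theorems/…CorankOne):

* R₃ — the pure gadget-generic rank-2 residue: a rank-2 first failure `x` all of whose exponentials `e^{M·x}` (`M ≠ 0`) are
  transcendental and whose gadgets `e^{x₀²}, e^{x₀x₁}, e^{x₁²}, e^{ix₀}, e^{ix₁}` are transcendental over `ℚ(x, eˣ)` has both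
  coordinates in `acl(∅)`;
* L — the log coordinates of every normal-form first failure of rank `n ≥ 3` with `r ≤ n − 2` log directions are in `acl(∅)`;
* S7′ — relative pure isolation at corank `≥ 2`: if the log coordinates are in `acl(∅)` then all coordinates are.

Every other sector is a tree theorem (log sector every rank, rank-2 mixed and gadget-algebraic sectors, corank-one sector of
every rank `≥ 3`).  This file states the three residues in ROUTE VOCABULARY (the bundle `x ∈ firstFailures n` and the set
`expAcl` inlined verbatim as in the route decl, so that they can be filed as route items) and proves

* `MinimalCounterexampleInAcl_of_subs : R₃ → L → S7′ → MinimalCounterexampleInAcl` (the `--glue-by` theorem), and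
* `minimalCounterexampleInAcl_iff_subs : MinimalCounterexampleInAcl ↔ R₃ ∧ L ∧ S7′` (losslessness: each child is necessary).

References: J. Kirby, *Exponential algebraicity in exponential fields*, Bull. LMS 42 (2010) = arXiv:0810.4285, Prop. 7.2;
status notes `Cruxes/MinimalCounterexampleInAcl/NOTES.md`, `…/Lines/kernel-arithmetic-selection-dead.md`,
`…/STRATEGY-CENSUS.md`.
-/

noncomputable section

open Complex Set FirstOrder

namespace Summit.Schanuel.Schanuel.Cruxes.MinimalCounterexampleInAcl.KernelArithmeticSelection

open Literature.NumberTheory.Transcendental (SchanuelRank)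
open Literature.ModelTheory.ExponentialFields
open Summit.Schanuel.Schanuel.Theorems.AclSubsetLogFreeCore.Negative (expAcl)

/-- **GLUE FOR THE LEAF SPLIT OF THE CRUX** (`--glue-by`; registered stub): (S*) follows from its three necessary residues R₃ (pure
gadget-generic rank 2), L (log coordinates at corank ≥ 2) and S7′ (relative pure isolation at corank ≥ 2), each stated in
route vocabulary.  Proof: `crux_of_pureTwistedResidue_of_corankGeTwo` (Theorems/…CorankOne) with the corank ≥ 2 sector
assembled as `S7′ ∘ L`; the inlined hypothesis bundles are `x ∈ firstFailures n` and `x i ∈ expAcl` by `Iff.rfl`.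
[cite: Kirby2010, Prop. 7.2] -/
theorem MinimalCounterexampleInAcl_of_subs : (∀ (x : Fin 2 → ℂ), LinearIndependent ℚ x → Algebra.trdeg ℚ ↥(IntermediateField.adjoin ℚ (Set.range x ∪ Set.range (Complex.exp ∘ x))) < ((2 : ℕ) : Cardinal) → (∀ k < 2, Literature.NumberTheory.Transcendental.SchanuelRank k) → (∀ M : Fin 2 → ℤ, M ≠ 0 → Transcendental ℚ (Complex.exp (∑ i, (M i : ℂ) * x i))) → Transcendental ↥(IntermediateField.adjoin ℚ (Set.range x ∪ Set.range (Complex.exp ∘ x))) (Complex.exp (x 0 ^ 2)) → Transcendental ↥(IntermediateField.adjoin ℚ (Set.range x ∪ Set.range (Complex.exp ∘ x))) (Complex.exp (x 0 * x 1)) → Transcendental ↥(IntermediateField.adjoin ℚ (Set.range x ∪ Set.range (Complex.exp ∘ x))) (Complex.exp (x 1 ^ 2)) → Transcendental ↥(IntermediateField.adjoin ℚ (Set.range x ∪ Set.range (Complex.exp ∘ x))) (Complex.exp (Complex.I * x 0)) → Transcendental ↥(IntermediateField.adjoin ℚ (Set.range x ∪ Set.range (Complex.exp ∘ x))) (Complex.exp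 (Complex.I * x 1)) → ∀ i, ∃ s : Set ℂ, s.Finite ∧ Set.Definable₁ (∅ : Set ℂ) Literature.ModelTheory.ExponentialFields.Language.expRing s ∧ x i ∈ s) → (∀ (n r : ℕ), 3 ≤ n → r + 2 ≤ n → ∀ (x : Fin n → ℂ), LinearIndependent ℚ x → Algebra.trdeg ℚ ↥(IntermediateField.adjoin ℚ (Set.range x ∪ Set.range (Complex.exp ∘ x))) < (n : Cardinal) → (∀ k < n, Literature.NumberTheory.Transcendental.SchanuelRank k) → (∀ i : Fin n, (i : ℕ) < r → IsAlgebraic ℚ (Complex.exp (x i))) → (∀ M : Fin n → ℤ, (∃ i : Fin n, r ≤ (i : ℕ) ∧ M i ≠ 0) → Transcendental ℚ (Complex.exp (∑ i, (M i : ℂ) * x i))) → ∀ i : Fin n, (i : ℕ) < r → ∃ s : Set ℂ, s.Finite ∧ Set.Definable₁ (∅ : Set ℂ) Literature.ModelTheory.ExponentialFields.Language.expRing s ∧ x i ∈ s) → (∀ (n r : ℕ), 3 ≤ n → r + 2 ≤ n → ∀ (x : Fin n → ℂ), LinearIndependent ℚ x → Algebra.trdeg ℚ ↥(IntermediateField.adjoin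 ℚ (Set.range x ∪ Set.range (Complex.exp ∘ x))) < (n : Cardinal) → (∀ k < n, Literature.NumberTheory.Transcendental.SchanuelRank k) → (∀ i : Fin n, (i : ℕ) < r → IsAlgebraic ℚ (Complex.exp (x i))) → (∀ M : Fin n → ℤ, (∃ i : Fin n, r ≤ (i : ℕ) ∧ M i ≠ 0) → Transcendental ℚ (Complex.exp (∑ i, (M i : ℂ) * x i))) → (∀ i : Fin n, (i : ℕ) < r → ∃ s : Set ℂ, s.Finite ∧ Set.Definable₁ (∅ : Set ℂ) Literature.ModelTheory.ExponentialFields.Language.expRing s ∧ x i ∈ s) → ∀ i, ∃ s : Set ℂ, s.Finite ∧ Set.Definable₁ (∅ : Set ℂ) Literature.ModelTheory.ExponentialFields.Language.expRing s ∧ x i ∈ s) → Summit.Schanuel.Schanuel.Theses.RigidCore.MinimalCounterexampleInAcl :=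
  fun hR hL hS =>
    crux_of_pureTwistedResidue_of_corankGeTwo
      (fun x hx hpure h00 h01 h11 hc0 hc1 => hR x hx.1 hx.2.1 hx.2.2 hpure h00 h01 h11 hc0 hc1)
      (fun n r hn hr x hx halg hpure =>
        hS n r hn hr x hx.1 hx.2.1 hx.2.2 halg hpure (hL n r hn hr x hx.1 hx.2.1 hx.2.2 halg hpure))

/-- **The split is LOSSLESS** (registered stub): (S*) is equivalent to the conjunction of its three children — each child is a
special case of the crux (R₃: rank 2 with extra hypotheses; L: the log coordinates `i < r`; S7′: an extra hypothesis), and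
conversely `MinimalCounterexampleInAcl_of_subs`. [cite: Kirby2010, Prop. 7.2] -/
theorem minimalCounterexampleInAcl_iff_subs : Summit.Schanuel.Schanuel.Theses.RigidCore.MinimalCounterexampleInAcl ↔ ((∀ (x : Fin 2 → ℂ), LinearIndependent ℚ x → Algebra.trdeg ℚ ↥(IntermediateField.adjoin ℚ (Set.range x ∪ Set.range (Complex.exp ∘ x))) < ((2 : ℕ) : Cardinal) → (∀ k < 2, Literature.NumberTheory.Transcendental.SchanuelRank k) → (∀ M : Fin 2 → ℤ, M ≠ 0 → Transcendental ℚ (Complex.exp (∑ i, (M i : ℂ) * x i))) → Transcendental ↥(IntermediateField.adjoin ℚ (Set.range x ∪ Set.range (Complex.exp ∘ x))) (Complex.exp (x 0 ^ 2)) → Transcendental ↥(IntermediateField.adjoin ℚ (Set.range x ∪ Set.range (Complex.exp ∘ x))) (Complex.exp (x 0 * x 1)) → Transcendental ↥(IntermediateField.adjoin ℚ (Set.range x ∪ Set.range (Complex.exp ∘ x))) (Complex.exp (x 1 ^ 2)) → Transcendental ↥(IntermediateField.adjoin ℚ (Set.range x ∪ Set.range (Complex.exp ∘ x))) (Complex.exp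 (Complex.I * x 0)) → Transcendental ↥(IntermediateField.adjoin ℚ (Set.range x ∪ Set.range (Complex.exp ∘ x))) (Complex.exp (Complex.I * x 1)) → ∀ i, ∃ s : Set ℂ, s.Finite ∧ Set.Definable₁ (∅ : Set ℂ) Literature.ModelTheory.ExponentialFields.Language.expRing s ∧ x i ∈ s) ∧ (∀ (n r : ℕ), 3 ≤ n → r + 2 ≤ n → ∀ (x : Fin n → ℂ), LinearIndependent ℚ x → Algebra.trdeg ℚ ↥(IntermediateField.adjoin ℚ (Set.range x ∪ Set.range (Complex.exp ∘ x))) < (n : Cardinal) → (∀ k < n, Literature.NumberTheory.Transcendental.SchanuelRank k) → (∀ i : Fin n, (i : ℕ) < r → IsAlgebraic ℚ (Complex.exp (x i))) → (∀ M : Fin n → ℤ, (∃ i : Fin n, r ≤ (i : ℕ) ∧ M i ≠ 0) → Transcendental ℚ (Complex.exp (∑ i, (M i : ℂ) * x i))) → ∀ i : Fin n, (i : ℕ) < r → ∃ s : Set ℂ, s.Finite ∧ Set.Definable₁ (∅ : Set ℂ) Literature.ModelTheory.ExponentialFields.Language.expRing s ∧ x i ∈ s) ∧ (∀ (n r : ℕ),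 3 ≤ n → r + 2 ≤ n → ∀ (x : Fin n → ℂ), LinearIndependent ℚ x → Algebra.trdeg ℚ ↥(IntermediateField.adjoin ℚ (Set.range x ∪ Set.range (Complex.exp ∘ x))) < (n : Cardinal) → (∀ k < n, Literature.NumberTheory.Transcendental.SchanuelRank k) → (∀ i : Fin n, (i : ℕ) < r → IsAlgebraic ℚ (Complex.exp (x i))) → (∀ M : Fin n → ℤ, (∃ i : Fin n, r ≤ (i : ℕ) ∧ M i ≠ 0) → Transcendental ℚ (Complex.exp (∑ i, (M i : ℂ) * x i))) → (∀ i : Fin n, (i : ℕ) < r → ∃ s : Set ℂ, s.Finite ∧ Set.Definable₁ (∅ : Set ℂ) Literature.ModelTheory.ExponentialFields.Language.expRing s ∧ x i ∈ s) → ∀ i, ∃ s : Set ℂ, s.Finite ∧ Set.Definable₁ (∅ : Set ℂ) Literature.ModelTheory.ExponentialFields.Language.expRing s ∧ x i ∈ s)) := by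
  constructor
  · intro h
    refine ⟨fun x hx htr hSR _ _ _ _ _ _ i => h 2 x hx htr hSR i, fun n r _ _ x hx htr hSR _ _ i _ => h n x hx htr hSR i,
      fun n r _ _ x hx htr hSR _ _ _ i => h n x hx htr hSR i⟩
  · rintro ⟨hR, hL, hS⟩
    exact MinimalCounterexampleInAcl_of_subs hR hL hS

end Summit.Schanuel.Schanuel.Cruxes.MinimalCounterexampleInAcl.KernelArithmeticSelection

end
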